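import Summits.BirchSwinnertonDyer.BirchSwinnertonDyer.Theorems.AdditiveBranchIMCGordTwoRankZeroDesc3Door
import Summits.BirchSwinnertonDyer.Rank1Residual.Supersingular.CountPointsFast
import Summits.BirchSwinnertonDyer.Rank1Residual.Supersingular.IntModelMinimalityKrausTwoMore
import Summits.BirchSwinnertonDyer.Rank1Residual.X11b.KrausMinimalityGeneralTwo
import Summits.BirchSwinnertonDyer.Rank1Residual.SecondDescent.X10aPrimeTargetsKernelCertificates
import Summits.BirchSwinnertonDyer.Rank1Residual.Additive.X3RankZeroSemistableTwistOdd
import Summits.BirchSwinnertonDyer.Rank1Residual.Additive.X3RankZeroSemistableTwist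
import Summits.BirchSwinnertonDyer.Rank1Residual.Additive.JValuationOfIntModel
import Summits.BirchSwinnertonDyer.Rank1Residual.Partition.EisensteinKernelCertificate
import Summits.BirchSwinnertonDyer.Rank1Residual.Partition.EisensteinKernelAbscissa
import Summits.BirchSwinnertonDyer.Rank1Residual.Additive.RationalLineOfKernelPolynomial
import Summits.BirchSwinnertonDyer.Rank1Residual.Additive.X3LineDatumFiveRecordsPrototype
import Literature.NumberTheory.EllipticCurves.Rank1Residual.Typed.CasselsLowerBound
import Literature.NumberTheory.EllipticCurves.Rank1Residual.GVParityTwistProofs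
import HarnessLib

/-!
# Route `AdditiveBranchIMC` (rung K1, cell `bsd-addord`), crux `GordTwoRankZeroOffCaseOne` (item stmt-BirchSwinnertonDyer-19357),
# registered stub `stub_reducibleNoCaseOne` — ISOGENY-DESCENT RECORDS 01: the LOWER half `MissingLowerBoundAt W p`
# (`ord_p #Ш_an ≤ ord_p #Ш`) on REDUCIBLE content rows of cell (G-ord, `e = 2`) ∩ `r_an = 0` ∩ `ord_p #Ш_an = 2` from TWO
# `p`-isogeny-descent engines of different method (a `--supports stmt-BirchSwinnertonDyer-19357 --as helper` file; seat
# `bsd-addord-k1-c2x` (lane B), gen 6)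

HONEST FRAMING. Per-row instances of the crux's conclusion on rows of `stub_reducibleNoCaseOne`'s domain (`r_an = 0`,
`N10.CellGordTwo W p`, `W[p]` REDUCIBLE); nothing here proves BSD, the stub or the crux (OPEN at class level: the off-Case-1
reducible rows are Greenberg–Vatsal μ-territory, no printed `⊆(𝓛)` on the ramified `ω^{(p−1)/2}` branch); THEOREMS ONLY (no
definition, no named fact, no `sorry`); LOWER half only — no upper-half door exists on these rows, so nothing here is a `BSDp`
record and nothing is booked (booking is referee A's). Rows in this file: `358275o1` @ 5.

ROAD (nobody's before: lane A's companion / DESC3 roads and gen 5's Kurihara road need `ρ̄_{E,p}` irreducible resp. onto;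
cell `bsd-litref`'s RESISO production ran the same engines on the `#Ш_an`-UNIT reducible rows only, to certify `Ш[p] = 0`):
for a rational `p`-isogeny `φ : E → Ê = E/C` the `φ`-Selmer group `Sel^φ(E/ℚ) ⊂ H¹(ℚ, E[φ])` is computed EXACTLY by two engines
of cell `b2b-bsdres` / `bsd-litref` (byte-identical production bundle `pub/bsd-litref/lw16/eng/lw16desc-prod-pv/`):
engine 1 = `isogchi.gp` (sha16 `42175383589206a2`; Miller-function Kummer map into the `χ`-eigenspace of `L(S,p)`, `L = ℚ(C)`,
S-units certified by `bnfcertify`, local images sampled to their exact Schaefer size) = kit j292739; engine 2 = `isogcft.gp`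
(sha16 `0e36e3a0a15125b0`; class-field-theoretic dual computation with its own duality check) = kit j292741; both on Cremona's curve 1 of the
class, FIELD-IDENTICAL on (`[L:ℚ]`, `χ(σ)`, `ŝ = dim Sel^φ̂(Ê)`, `s_φ = dim Sel^φ(E)`, `m`, EXCESS), `bnfcertify = 1` on both sides
in both engines (litref rules K2/K3). READING (rank `0` by GZK from the displayed `r_an = 0`; `E(ℚ)[p] = 0` on every row):
`Ш(E)[φ] ≅ Sel^φ(E) / (Ê(ℚ)/φE(ℚ))`, the Mordell–Weil term being `0` (`Ê(ℚ)[φ̂] = 0`, rows with `m = 0`) or `1`-dimensional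
(`Ê(ℚ)[φ̂] = Ĉ(ℚ) ≅ ℤ/3`, the `3B.1.2` rows with `m = 1`); on every row of this file `dim_𝔽ₚ Ш(E)[φ] = 1`, so `Ш(E)[p] ⊇ Ш(E)[φ] ≠ 0`
— the displayed certificate binder `hx : ∃ x ∈ Ш(E), x ≠ 0, p•x = 0` (X1 `IsogenousDescentDisplay…` precedent). DOOR (class-free,
cell `b2b-bsdres`): `Typed.missingLowerBoundAt_of_casselsTate_of_pow_dvd` — `p ∣ #Ш` (`dvd_shaOrder_of_exists_torsion`), `Ш` finite
(GZK `hGZK` at `r_an = 0`), `#Ш` a square (Cassels–Tate `hCT`) ⟹ `p² ∣ #Ш`, i.e. `ord_p #Ш_an = 2 ≤ ord_p #Ш`.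

IN THE KERNEL per record (`decide` / `norm_num` on Cremona's coefficients): `Δ ≠ 0`; global minimality of the literal model `W`
and of its good ordinary twist model `V = W^{(p*)}` (Kraus); `W[p]` REDUCIBLE (`p = 3`: a rational root `x₀` of `Ψ₃`;
`p = 5`: the kernel-polynomial certificate `preΨ'₅ = h·q`, doubling closure, `2` generates `𝔽₅ˣ` — `KernelPolyLine`); the cell
`N10.CellGordTwo W p` (`Addv W p` from `p ∣ Δ`, `p ∣ c₄`; `TypeGOrd W p` from the explicit isomorphism `C • V^{(p*)} = W` with `V`
good ORDINARY at `p` by its `𝔽_p`-point count and `ord_p j ≥ 0`; `e = 12/gcd(12, ord_p Δ_min) = 2` from `ord_p Δ = 6`).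
DISPLAYED binders: the register facts `hCT`, `hGZK`; Cremona's `r_an = 0` (`hr0`) and `#Ш_an = q`, `ord_p q ≤ 2` (`hq`, `hv`; value
quoted per record); the certificate `hx` (EVIDENCE quoted per record from the two kit jobs; fold table `CERTS-k1c2x-g6.tsv` on the item).
References: [SilvermanAEC2009] Thm. X.4.14, X.4.2, Ex. 3.7, VII.1 Rem. 1.1, VII.5 Prop. 5.1; [Cassels1965ArithmeticVIII];
[SchaeferStoll2004] (descent via isogeny; local image sizes: Schaefer, J. Number Theory 56 (1996) Lemma 3.8); [MilneADT2006] I.7;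
[GreenbergVatsal2000] §2 p. 28 (the off-Case-1 lines); [Miller2011LMS] Def. 1.1; [Kraus1989]; [Cremona1997] Table 1, §3.8.
-/

set_option autoImplicit false
set_option linter.dupNamespace false

noncomputable section

open scoped Classical

open WeierstrassCurve Polynomial Literature.NumberTheory.EllipticCurves
  Literature.NumberTheory.EllipticCurves.Rank1Residual
  Literature.NumberTheory.EllipticCurves.Rank1Residual.Typed
  Literature.NumberTheory.EllipticCurves.Rank1Residual.X11RankOneCertificates
  Literature.NumberTheory.GaloisRepresentations
  Summit.BirchSwinnertonDyer.BirchSwinnertonDyer.Rank1Residual.IntModel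
  Summit.BirchSwinnertonDyer.BirchSwinnertonDyer.Rank1Residual.X11RankOne
  Summit.BirchSwinnertonDyer.Rank1Residual
  Summit.BirchSwinnertonDyer.Rank1Residual.X11b
  Summit.BirchSwinnertonDyer.Rank1Residual.Supersingular
  Summit.BirchSwinnertonDyer.Rank1Residual.SecondDescent
  Summit.BirchSwinnertonDyer.Rank1Residual.Additive

namespace Summit.BirchSwinnertonDyer.BirchSwinnertonDyer.Theorems.AdditiveBranchIMCGordTwoRankZeroIsogenyDescent

/-! ### `358275o1` (class `358275o`, `N = 358275 = 3·5^2·17·281`; members: 358275o1 `#Ш_an = 25`, `#tors = 1`, `∏c = 1`, 358275o2 `#Ш_an = 25`, `#tors = 1`, `∏c = 5`; image `5B.1.4`) -/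

/-- `[0, -1, 1, 26742, 811793]` (Cremona's minimal model of `358275o1`) is an elliptic curve: `Δ = −3^5·5^6·17^5·281 ≠ 0`. [cite: Cremona1997, Table 1] -/
theorem isElliptic_i358275o1 : (⟨0, -1, 1, 26742, 811793⟩ : WeierstrassCurve ℚ).IsElliptic :=
  isElliptic_of_discOf_ne_zero 0 (-1) 1 26742 811793 (by decide +kernel)

/-- `[0, -1, 1, 26742, 811793]` (`358275o1`) is globally minimal (bounded Kraus form, kernel; `|Δ| = 3^5·5^6·17^5·281`). [cite: SilvermanAEC2009, VII.1 Remark 1.1] [cite: Kraus1989, Prop. 1 and Prop. 2] -/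
theorem isGloballyMinimal_i358275o1 : (⟨0, -1, 1, 26742, 811793⟩ : WeierstrassCurve ℚ).IsGloballyMinimal :=
  isGloballyMinimal_of_krausCriterion_bounded 0 (-1) 1 26742 811793
      (by decide +kernel) (by decide +kernel) (by decide +kernel)

/-- `[0, 1, 1, 1070, 6922]` (the good ordinary twist model `V = 358275o1^{(5)}`, conductor `14331`) is an elliptic curve: `Δ ≠ 0` (kernel). [cite: SilvermanAEC2009, III.1] -/
theorem isElliptic_iV358275o1 : (⟨0, 1, 1, 1070, 6922⟩ : WeierstrassCurve ℚ).IsElliptic :=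
  isElliptic_of_discOf_ne_zero 0 1 1 1070 6922 (by decide +kernel)

/-- `[0, 1, 1, 1070, 6922]` (twist model `V` of `358275o1`) is globally minimal (bounded Kraus form, kernel). [cite: SilvermanAEC2009, VII.1 Remark 1.1] [cite: Kraus1989, Prop. 1 and Prop. 2] -/
theorem isGloballyMinimal_iV358275o1 : (⟨0, 1, 1, 1070, 6922⟩ : WeierstrassCurve ℚ).IsGloballyMinimal :=
  isGloballyMinimal_of_krausCriterion_bounded 0 1 1 1070 6922
    (by decide +kernel) (by decide +kernel) (by decide +kernel)

/-- **`V = [0, 1, 1, 1070, 6922]` has good ORDINARY reduction at `5`** (kernel: `5 ∤ Δ(V)`, `#Ṽ(𝔽_5) = 5`, `a_5 = 1 ≢ 0 (mod 5)`). [cite: SilvermanAEC2009, VII.5 Prop. 5.1(a)] -/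
theorem goodOrd5_iV358275o1 : haveI := isGloballyMinimal_iV358275o1; GoodOrd (⟨0, 1, 1, 1070, 6922⟩ : WeierstrassCurve ℚ) 5 := by
  haveI := isGloballyMinimal_iV358275o1
  haveI : Fact (Nat.Prime 5) := ⟨by norm_num⟩
  have hI : integralModelInt (⟨0, 1, 1, 1070, 6922⟩ : WeierstrassCurve ℚ) = (⟨0, 1, 1, 1070, 6922⟩ : WeierstrassCurve ℤ) :=
    integralModelInt_eq_of_map_eq _ (map_mk_int 0 1 1 1070 6922)
  have hc : Nat.card (((⟨0, 1, 1, 1070, 6922⟩ : WeierstrassCurve ℤ).map (Int.castRingHom (ZMod 5))).toAffine.Point) = 5 := by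
    have h := natCard_point_eq_countPoints 0 1 1 1070 6922 5 (by norm_num) (by decide +kernel)
    have h' : countPoints [0, 1, 1, 1070, 6922] 5 = 5 := by decide +kernel
    exact_mod_cast h.trans h'
  exact SecondDescent.goodOrd_of_intModel 5 hI (by decide +kernel) hc (by decide)

/-- (c1) for `358275o1` at `5`: `preΨ'₅ = h · q` with the kernel polynomial `h = x^2 - 249*x - 756` of the rational `5`-isogeny `358275o1 → 358275o2`
(both engines) — `preΨ'₅ = preΨ₄·Ψ₂Sq² − Ψ₃³`, exact division checked in the kernel by `ring`. [cite: SilvermanAEC2009, Ex. 3.7] -/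
theorem preΨ'_five_i358275o1 :
    (⟨0, -1, 1, 26742, 811793⟩ : WeierstrassCurve ℚ).preΨ' 5 = (X ^ 2 + C (-249) * X + C (-756)) *
      (C 192549878836082180953245 + C 3907514423190254849100 * X + C 22327670554926680925 * X ^ 2 + C 472330589504968350 * X ^ 3 + C 3377854286070300 * X ^ 4 + C 36929191598055 * X ^ 5 + C 123927238575 * X ^ 6 + C 797007600 * X ^ 7 + C 1966825 * X ^ 8 + C 1225 * X ^ 9 + C 5 * X ^ 10) := by
  rw [show (5 : ℕ) = 2 * (0 + 2) + 1 from rfl, preΨ'_odd]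
  rw [if_pos (by decide : Even (0 : ℕ)), if_pos (by decide : Even (0 : ℕ))]
  simp only [zero_add, preΨ'_four, preΨ'_two, preΨ'_one, preΨ'_three, one_pow, mul_one]
  apply Polynomial.funext
  intro r
  simp only [preΨ₄, Ψ₃, Ψ₂Sq, b₂, b₄, b₆, b₈, eval_add, eval_sub, eval_mul, eval_pow, eval_C,
    eval_X, eval_ofNat, eval_one, eval_neg, map_neg]
  ring

/-- (c2) for `358275o1` at `5`: the doubling-closure identity `∑_{i ≤ 2} h_i Φ₂^i Ψ₂Sq^{2−i} = h · q₂`. [cite: SilvermanAEC2009, Ex. 3.7 (d)] -/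
theorem dbl_i358275o1 :
    ∑ i ∈ Finset.range (2 + 1), C ((X ^ 2 + C (-249) * X + C (-756) : ℚ[X]).coeff i) *
        (⟨0, -1, 1, 26742, 811793⟩ : WeierstrassCurve ℚ).Φ 2 ^ i *
        (⟨0, -1, 1, 26742, 811793⟩ : WeierstrassCurve ℚ).Ψ₂Sq ^ (2 - i) =
      (X ^ 2 + C (-249) * X + C (-756)) *
        (C 96221930355234 + C (-291131535042) * X + C (-6514895610) * X ^ 2 + C (-62419635) * X ^ 3 + C (-303315) * X ^ 4 + C (-747) * X ^ 5 + C 1 * X ^ 6) := by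
  have hc0 : ((X ^ 2 + C (-249) * X + C (-756) : ℚ[X])).coeff 0 = (-756) := by
    simp
  have hc1 : ((X ^ 2 + C (-249) * X + C (-756) : ℚ[X])).coeff 1 = ((-249)) := by
    simp
  have hc2 : ((X ^ 2 + C (-249) * X + C (-756) : ℚ[X])).coeff 2 = 1 := by
    simp
  simp only [Finset.sum_range_succ, Finset.sum_range_zero, zero_add, hc0, hc1, hc2, pow_zero, pow_one,
    Nat.sub_zero, Nat.sub_self, show 2 - 1 = 1 from rfl, mul_one, one_mul, map_one]
  apply Polynomial.funext
  intro r
  simp only [Φ_two, Ψ₂Sq, b₂, b₄, b₆, b₈, eval_add, eval_sub, eval_mul, eval_pow, eval_C, eval_X,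
    map_neg, eval_neg]
  ring

/-- **`358275o1[5]` contains a RATIONAL `5`-LINE** whose non-zero points lie above the roots of `h` (`KernelPolyLine.exists_isRationalLine_of_kernelPolyCert`
with (c1), (c2) and `2` generating `𝔽₅ˣ`). [cite: SilvermanAEC2009, Ex. 3.7 (b),(d),(f) and III.2.3] -/
theorem exists_isRationalLine_i358275o1 :
    ∃ Φ : AddSubgroup (geomTorsion (⟨0, -1, 1, 26742, 811793⟩ : WeierstrassCurve ℚ) ((5 : ℕ) : ℤ)),
      IsRationalLine ⟨0, -1, 1, 26742, 811793⟩ 5 Φ ∧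
      ∀ Q ∈ Φ, Q ≠ 0 → ∃ (x y : AlgebraicClosure ℚ)
        (hxy : ((⟨0, -1, 1, 26742, 811793⟩ : WeierstrassCurve ℚ).baseChange
          (AlgebraicClosure ℚ)).toAffine.Nonsingular x y),
        (Q : (⟨0, -1, 1, 26742, 811793⟩ : WeierstrassCurve ℚ).geomPoints) = Affine.Point.some x y hxy ∧
          ((X ^ 2 + C (-249) * X + C (-756) : ℚ[X]).map (algebraMap ℚ (AlgebraicClosure ℚ))).eval x = 0 := by
  haveI := isElliptic_i358275o1
  haveI : Fact (Nat.Prime 5) := ⟨by norm_num⟩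
  have e : (X ^ 2 + C (-249) * X + C (-756) : ℚ[X]) = C 1 * X ^ 2 + C ((-249)) * X + C ((-756)) := by
    rw [map_one, one_mul]
  have hdeg : (X ^ 2 + C (-249) * X + C (-756) : ℚ[X]).natDegree ≤ 2 := by
    rw [e]; exact natDegree_quadratic_le
  have hdeg2 : (X ^ 2 + C (-249) * X + C (-756) : ℚ[X]).natDegree = 2 := by
    rw [e]; exact natDegree_quadratic one_ne_zero
  refine KernelPolyLine.exists_isRationalLine_of_kernelPolyCert (by norm_num) (m := 2) rfl hdeg preΨ'_five_i358275o1
    dbl_i358275o1 KernelPolyLineRecords.gen_five ?_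
  have hne : (X ^ 2 + C (-249) * X + C (-756) : ℚ[X]) ≠ 0 :=
    ne_zero_of_natDegree_gt (n := 1) (by rw [hdeg2]; norm_num)
  have hd : ((X ^ 2 + C (-249) * X + C (-756) : ℚ[X]).map (algebraMap ℚ (AlgebraicClosure ℚ))).degree ≠ 0 := by
    rw [degree_map, degree_eq_natDegree hne, hdeg2]
    norm_num
  obtain ⟨α, hα⟩ := IsAlgClosed.exists_root _ hd
  exact ⟨α, hα⟩

/-- **`358275o1[5]` is REDUCIBLE — IN THE KERNEL** (the rational `5`-line of `exists_isRationalLine_i358275o1`). [cite: SilvermanAEC2009, Ex. 3.7] -/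
theorem not_irreducible_i358275o1 : ¬ (⟨0, -1, 1, 26742, 811793⟩ : WeierstrassCurve ℚ).HasIrreducibleModPGaloisRep 5 := by
  haveI := isElliptic_i358275o1
  haveI : Fact (Nat.Prime 5) := ⟨by norm_num⟩
  obtain ⟨Φ, hΦ, -⟩ := exists_isRationalLine_i358275o1
  exact not_hasIrreducibleModPGaloisRep_of_isRationalLine hΦ

/-- **Row `358275o1` @ `5` of crux 19357's stub `stub_reducibleNoCaseOne`: the row lies in the stub's domain — cell (G-ord, `e = 2`) `N10.CellGordTwo W 5`
and `W[5]` REDUCIBLE, both IN THE KERNEL — and the stub's conclusion L₀ = `ord_5 #Ш_an ≤ ord_5 #Ш` holds for it** (Cremona `358275o1` = `[0, -1, 1, 26742, 811793]`,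
`N = 358275 = 3·5^2·17·281`, `r_an = 0`, `#Ш_an = 25`, `#E(ℚ)_tors = 1`, `∏ c_ℓ = 1`; class `358275o` of 2 curves, `5² ∣ #Ш_an` on every member).
KERNEL: `Addv W 5` (`5 ∣ Δ`, `5 ∣ c₄`), `ord_5 j ≥ 0` (`5² ∣ c₄`, `5⁷ ∤ Δ`), the isomorphism `⟨1, -2, 0, 1/2⟩ • V^{(5)} = W` with
`V = [0, 1, 1, 1070, 6922]` good ordinary at `5` (`#Ṽ(𝔽_5) = 5`) ⟹ `TypeGOrd W 5`; `e = 12/gcd(12, ord_5 Δ_min) = 2` (`ord_5 Δ = 6`, Kodaira I₀*); reducibility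
(`not_irreducible_i358275o1`). DISPLAYED: `hCT` (Cassels–Tate), `hGZK`; `hr0`, `hq`/`hv` (`#Ш_an = 25`, `ord_5 = 2`); the certificate
`hx : Ш(W)[5] ≠ 0` — EVIDENCE (5-isogeny descent, kernel `C`: `h = x^2 - 249*x - 756`, `[ℚ(C):ℚ] = 2`, `χ(σ) = 4`, `Ê = 358275o2 = [0,-1,1,-2408508,-1439020207]`, `S = [3,5,17,281]`):
engine 1 `isogchi.gp` kit j292739 and engine 2 `isogcft.gp` kit j292741 AGREE on `ŝ = dim Sel^φ̂(Ê) = 1`, `s_φ = dim Sel^φ(W) = 1`, `m = 0`, EXCESS `= 2`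
(`bnfcertify` 1/1 / 1/1, isogcft duality PASS/PASS); Mordell–Weil part of `Sel^φ(W)` = `0` (`#W(ℚ)_tors = 1`, `#Ê(ℚ)_tors = 1` — no rational `5`-torsion on either side (Cremona), rank `0`: `Ê(ℚ)/φW(ℚ) = 0`) ⟹ **`dim Ш(W)[φ] = 1`**, `Ш(W)[5] ⊇ Ш(W)[φ] ≠ 0`.
LOWER half only; per row; NOT a class theorem; nothing booked; BSD is not proved by any of this.
[cite: SilvermanAEC2009, Thm. X.4.14 and Ex. 3.7] [cite: SchaeferStoll2004] [cite: Cremona1997, Table 1 (label 358275o1)] [cite: Miller2011LMS, Def. 1.1] -/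
theorem gordTwoLower_isog_i358275o1_5
    (hCT : exists_casselsTate_pairing (K := ℚ)) (hGZK : rank_eq_analyticRank_of_analyticRank_le_one)
    {W : WeierstrassCurve ℚ} [W.IsElliptic] [W.IsGloballyMinimal] (hWeq : W = ⟨0, -1, 1, 26742, 811793⟩)
    (hr0 : W.analyticRank = 0) {q : ℚ} (hq : shaAn W = (q : ℂ)) (hv : padicValRat 5 q ≤ 2)
    (hx : ∃ x : W.sha, x ≠ 0 ∧ 5 • x = 0) :
    N10.CellGordTwo W 5 ∧ ¬ W.HasIrreducibleModPGaloisRep 5 ∧ MissingLowerBoundAt W 5 := by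
  haveI : Fact (Nat.Prime 5) := ⟨by norm_num⟩
  haveI := isElliptic_iV358275o1
  haveI := isGloballyMinimal_iV358275o1
  have hIW : integralModelInt W = (⟨0, -1, 1, 26742, 811793⟩ : WeierstrassCurve ℤ) :=
    integralModelInt_eq_of_map_eq _ (by rw [hWeq]; ext <;> simp [WeierstrassCurve.map])
  have hadd : Addv W 5 := Additive.addv_of_intModel hIW 5 (by decide +kernel) (by decide +kernel)
  have hj : 0 ≤ padicValRat 5 W.j := padicValRat_j_nonneg_of_intModel hIW 5 2 (by decide +kernel) (by decide +kernel)
  have hWV : (⟨1, (-2 : ℚ), (0 : ℚ), ((1 : ℚ) / 2)⟩ : VariableChange ℚ) • (⟨0, 1, 1, 1070, 6922⟩ : WeierstrassCurve ℚ).quadraticTwist ((5 : ℕ) : ℚ) = W := by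
    rw [hWeq]
    ext <;> simp [WeierstrassCurve.variableChange_a₁, WeierstrassCurve.variableChange_a₂,
      WeierstrassCurve.variableChange_a₃, WeierstrassCurve.variableChange_a₄, WeierstrassCurve.variableChange_a₆,
      WeierstrassCurve.quadraticTwist, WeierstrassCurve.b₂, WeierstrassCurve.b₄, WeierstrassCurve.b₆] <;> norm_num
  have hG : TypeGOrd W 5 :=
    (typeGOrd_or_padicValRat_j_neg_of_twist W 5 (by norm_num) (⟨0, 1, 1, 1070, 6922⟩ : WeierstrassCurve ℚ) ⟨_, hWV⟩
      (Or.inl goodOrd5_iV358275o1)).resolve_right (not_lt.mpr hj)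
  have he : semistabilityIndex W 5 = 2 := by
    rw [semistabilityIndex, minimalDiscriminantInt_eq hIW, intCurve_Δ]; decide +kernel
  have hred : ¬ W.HasIrreducibleModPGaloisRep 5 := by rw [hWeq]; exact not_irreducible_i358275o1
  exact ⟨⟨by norm_num, hadd, hG, he⟩, hred,
    missingLowerBoundAt_of_casselsTate_of_pow_dvd W 5 hCT (hGZK W (by rw [hr0]; norm_num)).2 hq (k := 1)
      (by simpa using hv) (by simpa using dvd_shaOrder_of_exists_torsion W 5 hx)⟩

/-- **L₀ = `ord_5 #Ш_an ≤ ord_5 #Ш` for `358275o1`** — the crux's conclusion `MissingLowerBoundAt W 5` on this `stub_reducibleNoCaseOne` row, from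
`gordTwoLower_isog_i358275o1_5` (same binders). Per row; nothing booked. [cite: SilvermanAEC2009, Thm. X.4.14] [cite: Miller2011LMS, Def. 1.1] -/
theorem missingLowerBoundAt_i358275o1_5
    (hCT : exists_casselsTate_pairing (K := ℚ)) (hGZK : rank_eq_analyticRank_of_analyticRank_le_one)
    {W : WeierstrassCurve ℚ} [W.IsElliptic] [W.IsGloballyMinimal] (hWeq : W = ⟨0, -1, 1, 26742, 811793⟩)
    (hr0 : W.analyticRank = 0) {q : ℚ} (hq : shaAn W = (q : ℂ)) (hv : padicValRat 5 q ≤ 2)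
    (hx : ∃ x : W.sha, x ≠ 0 ∧ 5 • x = 0) : MissingLowerBoundAt W 5 :=
  (gordTwoLower_isog_i358275o1_5 hCT hGZK hWeq hr0 hq hv hx).2.2

end Summit.BirchSwinnertonDyer.BirchSwinnertonDyer.Theorems.AdditiveBranchIMCGordTwoRankZeroIsogenyDescent

end
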